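import Literature.MathematicalPhysics.QuantumFieldTheory.Balaban1983to89.B15Claim189N0OfRecord

/-!
# `Balaban1983to89.B15Claim189ZppPin` — YM-DAG node N12 · [Balaban1989LargeFieldI] CMP **122** (1989) 175–202, p. 179 (1.10)–(1.11): THE NEW LARGE-FIELD REGIONS `Z″_j`
# OF THE (1.89) SITUATION PINNED TO THE TERM'S CHAIN — `Z″_j = Z_j ∩ Z` (`j ≤ h`), `Z″_j = (Ω_j^{∼5})ᶜ ∩ Z` (`h < j ≤ k₀`), `Z″_{k₀+1} = (Ω_{k₀+1}^{∼7})ᶜ ∩ Z`,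
# `Z″_k = (Ω_{k₀+1}^{∼5})ᶜ ∩ Z` — and p. 200's *"We have j = k"* (module 4's `hjEqK`, module 11's `hZk`) DISCHARGED: `Z″_k` does not meet `Ω_m`, `m > k₀`

statement-level bookkeeping over published theorems with citation tags; kernel-checked compositions of tree theorems; nothing here is a claim about the Yang–Mills mass gap.

CITATION HEADER (lean-in-tree rule).  Source: [Balaban1989LargeFieldI] («[IV]») p. 179 (page image `…-p005-x2.png` re-read by this seat), verbatim: *"To specify the integrations we
define a new sequence of the large field regions. Let us recall that the domains Ω_j^{∼n} are unions of L^{−(k−j)}MR_j-cubes of the lattice T_η. Take the smallest positive integer N₀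
such, that L^{−N₀+1}MR_{k−N₀+1} = M. … Define Z″_k = (Z′_{k−N₀})^{∼3} = (Ω^{∼5}_{k−N₀+1})ᶜ ∩ Z, Z″_{k−N₀+1} = (Z′_{k−N₀})^∼ = (Ω^{∼7}_{k−N₀+1})ᶜ ∩ Z, (1.10) and complete these two
sets to a sequence Z″_k, Z″_{k−1}, …, Z″_{k−N₀+2}, Z″_{k−N₀+1} in such a way that the complements of these sets form an admissible sequence of domains based on partitions into M-cubes
in the corresponding scales. … Next, define Z″_j = (Ω_j^{∼5})ᶜ ∩ Z for j = k − N₀, k − N₀ − 1, …, k − N + 1 = h + 1, Z″_j = Z_j for j = h, h − 1, …, 1. (1.11)"*; p. 177 (*"we denote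
intersections of the regions Z_j with Z by Z_j also"*); [Balaban1988Convergent] (2.3) p. 255 (`Z_j = Λ_jᶜ`), (2.1) p. 254; p. 200 (*"Consider Ω_m∖Ω_{m+1} for k₀ < m < k. We have
j = k"*).  Seat `pub-ymgap-dag-n12-e` (YM-PLAN Track A, HUMAN RULING D-0062; director-ym R134 row N12 s3), module 13 (generation 4).  BY NAME and UNCHANGED: r11's `B14.Eq218Concrete.Seq`,
module 11 (`omegaOfChain`, `Sit189.pinTerm`, `sitOfTerm`), module 12 (`N0OfRecord`, `claim189_sitOfTerm_N0_of_inInterval ∕ _of_flow`, `two_le_N0OfRecord`, `one_lt_log_pow_of_inInterval`),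
Mathlib's `antitone_nat_of_succ_le`.

WHY THIS FILE.  After modules 11–12 the located GEOMETRIC inputs of the (1.89) display are `hZk : Z″_k ∩ Ω_m ⊆ Ω_{m+1}` (`k₀ < m < k`; print's *"We have j = k"*), the shell bound and
the (1.88) cube cover, over RESIDUAL regions `Z″_j`.  Print DEFINES the `Z″_j` ((1.10)–(1.11)) from the term's chain `{Ω_j, Λ_j}`, the final component union `Z` (a summation variable of
(1.99) — residual), two cube ENLARGEMENTS `∼5`, `∼7` (by layers of `L^{−(k−j)}MR_j`-cubes — here LETTERS `enl 5 j`, `enl 7 j` with the ONE property used, `S ⊆ S^{∼n}`) and, for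
`k₀ + 2 ≤ j ≤ k − 1`, a CHOICE (*"complete these two sets to a sequence … in such a way that"* — residual).  Pinning the four canonical ranges makes `Z″_k = (Ω^{∼5}_{k₀+1})ᶜ ∩ Z`, whence
`Z″_k ∩ Ω_m = ∅` for `m ≥ k₀ + 1` (`Ω_m ⊆ Ω_{k₀+1} ⊆ Ω^{∼5}_{k₀+1}`): `hZk` ∕ `hjEqK` become THEOREMS — the sentence *"We have j = k"* in kernel form.

WHAT THIS FILE PROVES (0 `sorry`; defs `zppOfChain`, `Node00.Sit189.pinZpp`, `Node00.ResidW.pinD189Z`).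
§1 (generic, r11's `Seq D k`) `zppOfChain` (+ `zppOfChain_low ∕ _mid ∕ _k₀succ ∕ _top` — the four printed ranges; `zppOfChain_top_inter_omega` — `Z″_k ∩ Ω_m = ∅`, `m ≥ k₀ + 1`;
   **`zppOfChain_hZk`** — module 11's `hZk` for the pinned `Z″`).
§2 `Sit189.pinZpp` (+ faces; ORDER: before module 7's χ′-pin, which reads `Z″`; commutes with `pinTerm` ∕ `pinNumerics` ∕ `pinDev0`).
§3 (at the record) **`claim189_sitOfTerm_N0Z_of_inInterval`** ∕ **`_of_flow`** (module 12's display theorems at the `Z″`-pinned situation with `hZk` DISCHARGED), `ResidW.pinD189Z` (+ faces),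
   **`h189_pinD189Z_of_h180`** ∕ **`_of_flow`**.

HONEST FRAMING.  Count-neutral: data transformers + set bookkeeping; nothing of Bałaban's asserted (`Z`, `Λ`, `Ω″`-regions, the interpolated `Z″_j` for `k₀+2 ≤ j ≤ k−1`, the
enlargements, cube data, `β, L₀, δ, B₃, B₅, O(1)`, `dist`, `devV″, dev97` stay residual; the shell bound, the (1.88) cover, the ℍ-leaves, (1.80), print's second condition, `N₀ ≤ N`,
`N₀ ≤ k`, window ∕ flow inputs, β ≥ 0 stay displayed); N12 NOT discharged; one finite four-torus programme at fixed `ε`, Bałaban AS PRINTED with locators; nothing continuum ∕ ℝ⁴ ∕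
OS ∕ mass gap ∕ Clay.  No `sorry`, no `axiom`, no `instance`, no `notation`.
-/

noncomputable section

open scoped BigOperators
open MeasureTheory

namespace Literature.MathematicalPhysics.QuantumFieldTheory.Balaban1983to89

namespace B15Claim189ZppPin

open B14.Eq218Concrete (Seq)
open B15Claim189PrintedConditions (omegaOfChain omegaOfChain_succ_subset)

/-! ## §1. Generic: print's `Z″_j` from the chain ((1.10)–(1.11)) -/

section Chain

variable {α : Type*} {D : ℕ → Set (Set α)} {k : ℕ}

/-- **THE NEW LARGE-FIELD REGIONS `Z″_j` OF (1.10)–(1.11) FROM THE TERM'S CHAIN**, for memories `N₀ ≤ Nm` (`h = k − Nm`, `k₀ = k − N₀`), the component union `Z`, an enlargement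
letter `enl n j S = S^{∼n}` (by `n` layers of scale-`j` cubes) and residual interpolating sets `Zres`: `Z″_j := Λ_jᶜ ∩ Z` for `j ≤ h` (*"Z″_j = Z_j"*, `Z_j = Λ_jᶜ` intersected with `Z`);
`(Ω_j^{∼5})ᶜ ∩ Z` for `h < j ≤ k₀`; `(Ω_{k₀+1}^{∼7})ᶜ ∩ Z` for `j = k₀ + 1`; `(Ω_{k₀+1}^{∼5})ᶜ ∩ Z` for `j = k`; `Zres j` otherwise (print's interpolated `Z″_{k₀+2}, …, Z″_{k−1}`
and the off-window levels).  `Ω_j` = the clamped chain `omegaOfChain s j`. [cite: Balaban1989LargeFieldI, (1.10)–(1.11) p.179; Balaban1988Convergent, (2.3) p.255] -/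
def zppOfChain (s : Seq D k) (N₀ Nm : ℕ) (Z : Set α) (enl : ℕ → ℕ → Set α → Set α) (Zres : ℕ → Set α) : ℕ → Set α := fun j =>
  if j + Nm ≤ k then (s.Λ j)ᶜ ∩ Z
  else if j + N₀ ≤ k then (enl 5 j (omegaOfChain s j))ᶜ ∩ Z
  else if j + N₀ = k + 1 then (enl 7 j (omegaOfChain s j))ᶜ ∩ Z
  else if j = k then (enl 5 (k + 1 - N₀) (omegaOfChain s (k + 1 - N₀)))ᶜ ∩ Z
  else Zres j

variable (s : Seq D k) (N₀ Nm : ℕ) (Z : Set α) (enl : ℕ → ℕ → Set α → Set α) (Zres : ℕ → Set α)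

/-- `j ≤ h = k − N`: `Z″_j = Z_j ∩ Z = Λ_jᶜ ∩ Z`. [cite: Balaban1989LargeFieldI, (1.11) p.179; Balaban1988Convergent, (2.3) p.255] -/
theorem zppOfChain_low {j : ℕ} (hj : j + Nm ≤ k) : zppOfChain s N₀ Nm Z enl Zres j = (s.Λ j)ᶜ ∩ Z := by
  simp only [zppOfChain, if_pos hj]

/-- `h < j ≤ k₀ = k − N₀`: `Z″_j = (Ω_j^{∼5})ᶜ ∩ Z`. [cite: Balaban1989LargeFieldI, (1.11) p.179] -/
theorem zppOfChain_mid {j : ℕ} (hjh : ¬ j + Nm ≤ k) (hj : j + N₀ ≤ k) : zppOfChain s N₀ Nm Z enl Zres j = (enl 5 j (omegaOfChain s j))ᶜ ∩ Z := by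
  simp only [zppOfChain, if_neg hjh, if_pos hj]

/-- `j = k₀ + 1`: `Z″_{k−N₀+1} = (Ω^{∼7}_{k−N₀+1})ᶜ ∩ Z` (for `N₀ ≤ Nm`, `N₀ ≤ k + 1`). [cite: Balaban1989LargeFieldI, (1.10) p.179] -/
theorem zppOfChain_k₀succ (hNm : N₀ ≤ Nm) (hNk : N₀ ≤ k + 1) :
    zppOfChain s N₀ Nm Z enl Zres (k + 1 - N₀) = (enl 7 (k + 1 - N₀) (omegaOfChain s (k + 1 - N₀)))ᶜ ∩ Z := by
  have h1 : ¬ (k + 1 - N₀) + Nm ≤ k := by omega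
  have h2 : ¬ (k + 1 - N₀) + N₀ ≤ k := by omega
  have h3 : (k + 1 - N₀) + N₀ = k + 1 := by omega
  simp only [zppOfChain, if_neg h1, if_neg h2, if_pos h3]

/-- `j = k`: `Z″_k = (Ω^{∼5}_{k−N₀+1})ᶜ ∩ Z` (for `2 ≤ N₀ ≤ Nm`). [cite: Balaban1989LargeFieldI, (1.10) p.179] -/
theorem zppOfChain_top (hN2 : 2 ≤ N₀) (hNm : N₀ ≤ Nm) :
    zppOfChain s N₀ Nm Z enl Zres k = (enl 5 (k + 1 - N₀) (omegaOfChain s (k + 1 - N₀)))ᶜ ∩ Z := by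
  have h1 : ¬ k + Nm ≤ k := by omega
  have h2 : ¬ k + N₀ ≤ k := by omega
  have h3 : ¬ k + N₀ = k + 1 := by omega
  simp only [zppOfChain, if_neg h1, if_neg h2, if_neg h3, if_true]

/-- **«WE HAVE j = k» — `Z″_k` DOES NOT MEET `Ω_m`, `m ≥ k₀ + 1`**: `Ω_m ⊆ Ω_{k₀+1} ⊆ Ω^{∼5}_{k₀+1}` ((2.1) nesting, the enlargement inflationary) while `Z″_k ⊆ (Ω^{∼5}_{k₀+1})ᶜ`.
[cite: Balaban1989LargeFieldI, p.200 («Consider Ω_m∖Ω_{m+1} for k₀ < m < k. We have j = k»), (1.10) p.179] -/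
theorem zppOfChain_top_inter_omega (henl : ∀ n j (S : Set α), S ⊆ enl n j S) (hN2 : 2 ≤ N₀) (hNm : N₀ ≤ Nm) {m : ℕ} (hm : k + 1 - N₀ ≤ m) :
    zppOfChain s N₀ Nm Z enl Zres k ∩ omegaOfChain s m = ∅ := by
  rw [zppOfChain_top s N₀ Nm Z enl Zres hN2 hNm, Set.eq_empty_iff_forall_notMem]
  rintro x ⟨⟨hxZ, -⟩, hxm⟩
  exact hxZ (henl 5 _ _ ((antitone_nat_of_succ_le (omegaOfChain_succ_subset s)) hm hxm))

/-- **MODULE 11's `hZk` FOR THE PINNED `Z″`** (hence module 4's `hjEqK`): `Z″_k ∩ Ω_m ⊆ Ω_{m+1}` for `k − N₀ < m` (indeed the left side is empty).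
[cite: Balaban1989LargeFieldI, p.200, (1.10) p.179] -/
theorem zppOfChain_hZk (henl : ∀ n j (S : Set α), S ⊆ enl n j S) (hN2 : 2 ≤ N₀) (hNm : N₀ ≤ Nm) :
    ∀ m, k - N₀ < m → m < k → zppOfChain s N₀ Nm Z enl Zres k ∩ omegaOfChain s m ⊆ omegaOfChain s (m + 1) := by
  intro m hm _
  rw [zppOfChain_top_inter_omega s N₀ Nm Z enl Zres henl hN2 hNm (by omega)]
  exact Set.empty_subset _

end Chain

/-! ## §2. The (1.89) situation with its `Z″_j` pinned -/

section Pin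

open DagBinding T4Continuum Node00

variable {F : T4Family} {N : ℕ} [NeZero N]

/-- **THE (1.89) SITUATION OF A TERM WITH ITS NEW LARGE-FIELD REGIONS `Z″_j` PINNED** ((1.10)–(1.11)): `Zpp := zppOfChain s N₀ Nm σ.Z enl σ.Zpp` — the term's chain `s`, memories
`N₀ ≤ Nm`, the situation's own component union `Z` (residual: the final `Z` of §1 is a summation variable of (1.99)), an enlargement letter `enl`, the situation's old `Z″` as the
interpolating residue.  ORDER: before module 7's χ′-pin (which reads `Z″`); independent of `pinTerm` ∕ `pinNumerics` ∕ `pinDev0`.  Data, no law.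
[cite: Balaban1989LargeFieldI, (1.10)–(1.11) p.179, (1.89) p.198] -/
def _root_.Literature.MathematicalPhysics.QuantumFieldTheory.Balaban1983to89.Node00.Sit189.pinZpp {K : ℕ} (σ : Sit189 F N K)
    {D : ℕ → Set (Set (Site (F.P K) 0))} {k' : ℕ} (s : Seq D k') (N₀ Nm : ℕ) (enl : ℕ → ℕ → Set (Site (F.P K) 0) → Set (Site (F.P K) 0)) : Sit189 F N K :=
  { σ with Zpp := zppOfChain s N₀ Nm σ.Z enl σ.Zpp }

variable {K : ℕ} (σ : Sit189 F N K) {D : ℕ → Set (Set (Site (F.P K) 0))} {k' : ℕ} (s : Seq D k') (N₀ Nm : ℕ)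
  (enl : ℕ → ℕ → Set (Site (F.P K) 0) → Set (Site (F.P K) 0))

/-- The pinned `Z″` (`rfl`). [cite: Balaban1989LargeFieldI, (1.10)–(1.11) p.179 (bookkeeping)] -/
theorem pinZpp_Zpp : (σ.pinZpp s N₀ Nm enl).Zpp = zppOfChain s N₀ Nm σ.Z enl σ.Zpp := rfl

/-- The pin keeps everything else (`rfl`): levels, `Ω, Z, Λ, Ω″`-regions, cube data, numbers, letters. [cite: Balaban1989LargeFieldI, (1.89) p.198 (bookkeeping)] -/
theorem pinZpp_kept : (σ.pinZpp s N₀ Nm enl).k = σ.k ∧ (σ.pinZpp s N₀ Nm enl).h = σ.h ∧ (σ.pinZpp s N₀ Nm enl).k₀ = σ.k₀ ∧ (σ.pinZpp s N₀ Nm enl).Ω = σ.Ω ∧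
    (σ.pinZpp s N₀ Nm enl).Z = σ.Z ∧ (σ.pinZpp s N₀ Nm enl).Λ = σ.Λ ∧ (σ.pinZpp s N₀ Nm enl).OmT = σ.OmT ∧ (σ.pinZpp s N₀ Nm enl).ΩppT2 = σ.ΩppT2 ∧
    (σ.pinZpp s N₀ Nm enl).β = σ.β ∧ (σ.pinZpp s N₀ Nm enl).L₀ = σ.L₀ ∧ (σ.pinZpp s N₀ Nm enl).δ = σ.δ ∧ (σ.pinZpp s N₀ Nm enl).B₃ = σ.B₃ ∧
    (σ.pinZpp s N₀ Nm enl).B₅ = σ.B₅ ∧ (σ.pinZpp s N₀ Nm enl).O1 = σ.O1 ∧ (σ.pinZpp s N₀ Nm enl).dist = σ.dist ∧ (σ.pinZpp s N₀ Nm enl).dev0 = σ.dev0 :=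
  ⟨rfl, rfl, rfl, rfl, rfl, rfl, rfl, rfl, rfl, rfl, rfl, rfl, rfl, rfl, rfl, rfl⟩

/-- The `Z″`-pin commutes with module 11's term pin, module 10's numbers pin and module 8's `dev0` pin (`rfl`: disjoint fields, and it reads only `Z`, the old `Z″` and its parameters).
[cite: Balaban1989LargeFieldI, (1.89) p.198 (bookkeeping)] -/
theorem pinZpp_comm (τ : TowerNumerics) (M₀ : ℕ) (ν : Stage7Numerics) :
    (σ.pinZpp s N₀ Nm enl).pinTerm s = (σ.pinTerm s).pinZpp s N₀ Nm enl ∧ (σ.pinZpp s N₀ Nm enl).pinNumerics τ M₀ = (σ.pinNumerics τ M₀).pinZpp s N₀ Nm enl ∧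
      (σ.pinZpp s N₀ Nm enl).pinDev0 ν = (σ.pinDev0 ν).pinZpp s N₀ Nm enl := ⟨rfl, rfl, rfl⟩

end Pin

/-! ## §3. At NODE 00's record: the (1.89) display at the `Z″`-pinned term situation — `hZk` discharged -/

section AtRecord

open DagBinding T4Continuum Node00
open B15 (Ineq180)
open B15.BasicStep (Claim189)
open B15.PrelimIntegrations (Ineq191 Ineq195)
open B15Chi124DetSets (E124)
open B15Claim189Assembly (Setting189 new189 chiPP X dom domK half)
open B15Claim189PinAtRecord (D189OfRecord)
open B15Claim189PrintedConditions (sitOfTerm)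
open B15Claim189N0OfRecord (N0OfRecord claim189_sitOfTerm_N0_of_inInterval claim189_sitOfTerm_N0_of_flow two_le_N0OfRecord one_lt_log_pow_of_inInterval)
open B15DeterminingSets (MSField)
open B14DomainGeom (Pt)
open B8Eq17ClassAkV1 (plaqsOf)
open GaugeGroup (dist1)
open GaugeField (plaqHol)
open FlowStep (HBeta prefixOf BetaUpperH)
open B14FlowStep (SmallnessFor)

variable {F : T4Family} {N : ℕ} [NeZero N] {θ : Stage9Params F N} (P : B12.RunParams) (σ : Sit189 F N P.K) {k' : ℕ}
  (s : SeqOfRecord F θ.ν θ.τ9.M (gOfRecord₁₀ F N θ P) P.K k') (p₁ : ℕ) (enl : ℕ → ℕ → Set (Site (F.P P.K) 0) → Set (Site (F.P P.K) 0))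

/-- **(1.89) AT THE TERM'S FULLY PINNED LETTERS WITH `N₀` OF RECORD AND PRINT'S `Z″_j` — p. 200's *"We have j = k"* NO LONGER A HYPOTHESIS**: module 12's `claim189_sitOfTerm_N0_of_inInterval`
at the `Z″`-pinned situation `σ.pinZpp s (N0OfRecord θ P k′) θ.τ9.Nmem enl`, its `hZk` supplied by `zppOfChain_hZk` (enlargement inflationary: `henl`; `2 ≤ N₀` from the window,
`N₀ ≤ Nmem` displayed).  For `D = D189OfRecord θ P (sitOfTerm θ P (σ.pinZpp …) s (N0OfRecord θ P k′) p₁)` (`hD`, instantiate `rfl`).  Still displayed: `r ≥ 1`, `N₀(P) ≤ N`, `N₀(P) ≤ k′`,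
`β, L₀`, signs, the threshold, `β ≥ 0`, print's second condition, the window, the shell bound, the (1.88) cover, the four ℍ-leaves, (1.80).
[cite: Balaban1989LargeFieldI, (1.89) p.198, pp.199–200, (1.10)–(1.11) p.179; Balaban1988Convergent, (2.1) p.254, (2.5)–(2.8) pp.255–256] -/
theorem claim189_sitOfTerm_N0Z_of_inInterval (henl : ∀ n j (S : Set (Site (F.P P.K) 0)), S ⊆ enl n j S)
    {D : Setting189 (F.P P.K) (SU N) (MSField (F.P P.K) (SU N) × ((j : ℕ) → VecField (F.P P.K) j (EuclideanSpace ℝ (Fin (N ^ 2 - 1))))) (Pt (F.P P.K).d)}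
    (hD : D = D189OfRecord θ P (sitOfTerm θ P (σ.pinZpp s (N0OfRecord θ P k') θ.τ9.Nmem enl) s (N0OfRecord θ P k') p₁))
    (hr : 1 ≤ θ.ν.r) (hNN : N0OfRecord θ P k' ≤ θ.τ9.Nmem) (hNk : N0OfRecord θ P k' ≤ k')
    (hβ0 : 0 ≤ σ.β) (hβ : σ.β ≤ 1 / 4) (hL₀ : 2 ≤ σ.L₀) (hL₀L : σ.L₀ ^ 2 ≤ ((F.P P.K).L : ℝ))
    (hB : 0 ≤ σ.O1 * σ.B₃ * σ.B₅) (hδ : 0 ≤ σ.δ) (hdist : ∀ p, 0 ≤ σ.dist p)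
    (hwin : 4 * (2 + (121 / 120) ^ 2 * (σ.O1 * σ.B₃ * σ.B₅ * (θ.τ9.M : ℝ) ^ 5))
      ≤ ((Real.log (gOfRecord₁₀ F N θ P k' ^ 2)⁻¹) ^ θ.ν.r) ^ (Real.log (σ.L₀ ^ 2) / Real.log ((F.P P.K).L : ℝ)))
    (hβhist : ∀ j, j < k' → 0 ≤ betaOfRecord₁₀ F N θ j (prefixOf (gOfRecord₁₀ F N θ P) j))
    (hMl : (121 / 120) ^ 2 * (σ.O1 * σ.B₃ * σ.B₅ * (θ.τ9.M : ℝ) ^ 5) * Real.exp (-(4 * σ.δ * (θ.τ9.M : ℝ))) ≤ 1 / 12)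
    (hA₀ : 0 ≤ θ.ν.A₀) {β' β₀ : ℝ} {L : ℕ} (S : SmallnessFor θ.γ β' β₀ L θ.ν.p₀) (hβ₀ : β₀ ≤ 1 / 2)
    (hε10 : θ.γ * p0Profile θ.ν.A₀ θ.ν.p₀ θ.γ ≤ 1 / 10)
    (hI : Step.InInterval θ.γ k' (gOfRecord₁₀ F N θ P))
    (hub : ∀ j, j < k' → betaOfRecord₁₀ F N θ j (prefixOf (gOfRecord₁₀ F N θ P) j) ≤ β')
    (hgeom : ∀ m, D.k₀ < m → m < D.k → ∀ p ∈ plaqsOf (D.Ω m \ D.Ω (m + 1)), 4 * ((m : ℝ) - D.k₀) * D.M ≤ D.dist p)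
    (hbox : ∀ p ∈ plaqsOf (half D), D.boxOf p ∈ D.halfcubes ∧ p ∈ D.plaqT (D.boxOf p))
    (L91h : ∀ U, new189 D U → ∀ p ∈ plaqsOf (half D),
      Ineq191 (dist1 (plaqHol (D.Upp U) p)) (D.devV'' U p) D.α ((D.L ^ D.h)⁻¹) (D.ε D.h) (E124 D.ε D.L D.η D.k D.h))
    (L95 : ∀ U, new189 D U → ∀ p ∈ plaqsOf (half D),
      Ineq195 (D.devV'' U p) (dist1 (plaqHol (D.Uhalf U (D.boxOf p)) p)) D.α ((D.L ^ D.h)⁻¹) (D.ε D.h) (E124 D.ε D.L D.η D.k D.h))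
    (L91 : ∀ U, new189 D U → ∀ j, D.h ≤ j → j ≤ D.k → ∀ p ∈ plaqsOf (dom D j),
      Ineq191 (dist1 (plaqHol (D.Upp U) p)) (D.dev97 U p) D.α ((D.L ^ j)⁻¹) (D.ε j) (E124 D.ε D.L D.η D.k j))
    (L97 : ∀ U, new189 D U → ∀ j, D.h ≤ j → j ≤ D.k → ∀ p ∈ plaqsOf (dom D j),
      Ineq191 (D.dev97 U p) (D.dev0 U p) D.α ((D.L ^ j)⁻¹) (D.ε j) (E124 D.ε D.L D.η D.k j))
    (L80 : ∀ U, new189 D U → ∀ j, D.h ≤ j → j ≤ D.k → ∀ p ∈ plaqsOf (dom D j),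
      Ineq180 (D.dev0 U p) (D.ε D.k) D.η D.B₃ D.B₅ D.M D.δ (D.dist p) D.O1) :
    Claim189 (new189 D) (chiPP D) :=
  claim189_sitOfTerm_N0_of_inInterval (σ.pinZpp s (N0OfRecord θ P k') θ.τ9.Nmem enl) s p₁ hD hr hNN hNk hβ0 hβ hL₀ hL₀L hB hδ hdist hwin hβhist hMl hA₀ S hβ₀ hε10 hI hub
    (zppOfChain_hZk s (N0OfRecord θ P k') θ.τ9.Nmem σ.Z enl σ.Zpp henl (two_le_N0OfRecord θ P k' (one_lt_log_pow_of_inInterval S hI hr)) hNN)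
    hgeom hbox L91h L95 L91 L97 L80

/-- **THE SAME, WINDOW-FREE FORM** (module 12's `claim189_sitOfTerm_N0_of_flow` with `hZk` discharged; `2 ≤ N₀` from `1 < (log g_{k′}⁻²)^r`).
[cite: Balaban1989LargeFieldI, (1.89) p.198, pp.199–200, (1.10)–(1.11) p.179; Balaban1988Convergent, (2.5)–(2.8) pp.255–256] -/
theorem claim189_sitOfTerm_N0Z_of_flow (henl : ∀ n j (S : Set (Site (F.P P.K) 0)), S ⊆ enl n j S)
    {D : Setting189 (F.P P.K) (SU N) (MSField (F.P P.K) (SU N) × ((j : ℕ) → VecField (F.P P.K) j (EuclideanSpace ℝ (Fin (N ^ 2 - 1))))) (Pt (F.P P.K).d)}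
    (hD : D = D189OfRecord θ P (sitOfTerm θ P (σ.pinZpp s (N0OfRecord θ P k') θ.τ9.Nmem enl) s (N0OfRecord θ P k') p₁))
    (hg1 : 1 < (Real.log (gOfRecord₁₀ F N θ P k' ^ 2)⁻¹) ^ θ.ν.r) (hNN : N0OfRecord θ P k' ≤ θ.τ9.Nmem) (hNk : N0OfRecord θ P k' ≤ k')
    (hβ0 : 0 ≤ σ.β) (hβ : σ.β ≤ 1 / 4) (hL₀ : 2 ≤ σ.L₀) (hL₀L : σ.L₀ ^ 2 ≤ ((F.P P.K).L : ℝ))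
    (hB : 0 ≤ σ.O1 * σ.B₃ * σ.B₅) (hδ : 0 ≤ σ.δ) (hdist : ∀ p, 0 ≤ σ.dist p)
    (hwin : 4 * (2 + (121 / 120) ^ 2 * (σ.O1 * σ.B₃ * σ.B₅ * (θ.τ9.M : ℝ) ^ 5))
      ≤ ((Real.log (gOfRecord₁₀ F N θ P k' ^ 2)⁻¹) ^ θ.ν.r) ^ (Real.log (σ.L₀ ^ 2) / Real.log ((F.P P.K).L : ℝ)))
    {γ : ℝ} (hγ1 : γ ≤ 1) (hIγ : Step.InInterval γ k' (gOfRecord₁₀ F N θ P))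
    (hβhist : ∀ j, j < k' → 0 ≤ betaOfRecord₁₀ F N θ j (prefixOf (gOfRecord₁₀ F N θ P) j))
    (hMl : (121 / 120) ^ 2 * (σ.O1 * σ.B₃ * σ.B₅ * (θ.τ9.M : ℝ) ^ 5) * Real.exp (-(4 * σ.δ * (θ.τ9.M : ℝ))) ≤ 1 / 12)
    (hε0 : ∀ i, k' - θ.τ9.Nmem ≤ i → i ≤ k' → 0 ≤ epsOfRecord θ.ν (gOfRecord₁₀ F N θ P) i)
    (hε1 : ∀ i, k' - θ.τ9.Nmem ≤ i → i ≤ k' → epsOfRecord θ.ν (gOfRecord₁₀ F N θ P) i ≤ 1 / 10)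
    {β₀ : ℝ} (hβ₀0 : 0 ≤ β₀) (hβ₀ : β₀ ≤ 1 / 2)
    (hflow : ∀ j, k' - θ.τ9.Nmem ≤ j → j < k' →
      epsOfRecord θ.ν (gOfRecord₁₀ F N θ P) k' ≤ (1 + β₀) * Real.sqrt ((k' - j : ℕ) : ℝ) * epsOfRecord θ.ν (gOfRecord₁₀ F N θ P) j)
    (hgeom : ∀ m, D.k₀ < m → m < D.k → ∀ p ∈ plaqsOf (D.Ω m \ D.Ω (m + 1)), 4 * ((m : ℝ) - D.k₀) * D.M ≤ D.dist p)
    (hbox : ∀ p ∈ plaqsOf (half D), D.boxOf p ∈ D.halfcubes ∧ p ∈ D.plaqT (D.boxOf p))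
    (L91h : ∀ U, new189 D U → ∀ p ∈ plaqsOf (half D),
      Ineq191 (dist1 (plaqHol (D.Upp U) p)) (D.devV'' U p) D.α ((D.L ^ D.h)⁻¹) (D.ε D.h) (E124 D.ε D.L D.η D.k D.h))
    (L95 : ∀ U, new189 D U → ∀ p ∈ plaqsOf (half D),
      Ineq195 (D.devV'' U p) (dist1 (plaqHol (D.Uhalf U (D.boxOf p)) p)) D.α ((D.L ^ D.h)⁻¹) (D.ε D.h) (E124 D.ε D.L D.η D.k D.h))
    (L91 : ∀ U, new189 D U → ∀ j, D.h ≤ j → j ≤ D.k → ∀ p ∈ plaqsOf (dom D j),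
      Ineq191 (dist1 (plaqHol (D.Upp U) p)) (D.dev97 U p) D.α ((D.L ^ j)⁻¹) (D.ε j) (E124 D.ε D.L D.η D.k j))
    (L97 : ∀ U, new189 D U → ∀ j, D.h ≤ j → j ≤ D.k → ∀ p ∈ plaqsOf (dom D j),
      Ineq191 (D.dev97 U p) (D.dev0 U p) D.α ((D.L ^ j)⁻¹) (D.ε j) (E124 D.ε D.L D.η D.k j))
    (L80 : ∀ U, new189 D U → ∀ j, D.h ≤ j → j ≤ D.k → ∀ p ∈ plaqsOf (dom D j),
      Ineq180 (D.dev0 U p) (D.ε D.k) D.η D.B₃ D.B₅ D.M D.δ (D.dist p) D.O1) :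
    Claim189 (new189 D) (chiPP D) :=
  claim189_sitOfTerm_N0_of_flow (σ.pinZpp s (N0OfRecord θ P k') θ.τ9.Nmem enl) s p₁ hD hg1 hNN hNk hβ0 hβ hL₀ hL₀L hB hδ hdist hwin hγ1 hIγ hβhist hMl hε0 hε1 hβ₀0 hβ₀
    hflow (zppOfChain_hZk s (N0OfRecord θ P k') θ.τ9.Nmem σ.Z enl σ.Zpp henl (two_le_N0OfRecord θ P k' hg1) hNN) hgeom hbox L91h L95 L91 L97 L80

end AtRecord

section Layer

open DagBinding T4Continuum Node00
open B15 (Ineq180)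
open B15.BasicStep (Claim189)
open B15.PrelimIntegrations (Ineq191 Ineq195)
open B15Chi124DetSets (E124)
open B15Claim189Assembly (Setting189 new189 chiPP X dom domK half)
open B15Claim189PinAtRecord (D189OfRecord)
open B15Claim189PrintedConditions (sitOfTerm)
open B15Claim189N0OfRecord (N0OfRecord)
open B15DeterminingSets (MSField)
open B14DomainGeom (Pt)
open B8Eq17ClassAkV1 (plaqsOf)
open GaugeGroup (dist1)
open GaugeField (plaqHol)
open FlowStep (HBeta prefixOf BetaUpperH)
open B14FlowStep (SmallnessFor)

variable {F : T4Family} {N : ℕ} [NeZero N]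

/-- **THE RESIDUAL [IV] LAYER WITH THE (1.89) LETTERS PINNED TO THE RECORD'S OBJECTS INCLUDING `N₀` OF RECORD AND PRINT'S `Z″_j`**: module 12's `pinD189N` at the `Z″`-pinned
situations (per run: the term `s P`, `N₀ := N0OfRecord θ P (kSel P + 1)`, `N := τ9.Nmem`, an enlargement letter `enl P`).  Data, no law.
[cite: Balaban1989LargeFieldI, (1.89) p.198, (1.10)–(1.11) p.179, p.200] -/
def _root_.Literature.MathematicalPhysics.QuantumFieldTheory.Balaban1983to89.Node00.ResidW.pinD189Z (lam : ResidW F N) (θ : Stage9Params F N)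
    (σ : ∀ P : B12.RunParams, Sit189 F N P.K)
    (s : ∀ P : B12.RunParams, SeqOfRecord F θ.ν θ.τ9.M (gOfRecord₁₀ F N θ P) P.K (lam.kSel P + 1))
    (enl : ∀ P : B12.RunParams, ℕ → ℕ → Set (Site (F.P P.K) 0) → Set (Site (F.P P.K) 0)) (p₁ : ℕ) : ResidW F N :=
  lam.pinD189N θ (fun P => (σ P).pinZpp (s P) (N0OfRecord θ P (lam.kSel P + 1)) θ.τ9.Nmem (enl P)) s p₁

variable (θ : Stage9Params F N) (lam : ResidW F N) (σT : ∀ P : B12.RunParams, Sit189 F N P.K)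
  (sT : ∀ P : B12.RunParams, SeqOfRecord F θ.ν θ.τ9.M (gOfRecord₁₀ F N θ P) P.K (lam.kSel P + 1))
  (enl : ∀ P : B12.RunParams, ℕ → ℕ → Set (Site (F.P P.K) 0) → Set (Site (F.P P.K) 0)) (p₁ : ℕ)

/-- Unfolding (`rfl`). [cite: Balaban1989LargeFieldI, (1.89) p.198 (bookkeeping)] -/
theorem pinD189Z_eq : lam.pinD189Z θ σT sT enl p₁ = lam.pinD189N θ (fun P => (σT P).pinZpp (sT P) (N0OfRecord θ P (lam.kSel P + 1)) θ.τ9.Nmem (enl P)) sT p₁ := rfl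

/-- At run `P` its letters ARE those of module 11's term-pinned layer at the `Z″`-pinned situations and `N₀` of record (`rfl`). [cite: Balaban1989LargeFieldI, (1.89) p.198 (bookkeeping)] -/
theorem pinD189Z_D189 (P : B12.RunParams) : (lam.pinD189Z θ σT sT enl p₁).D189 P =
    D189OfRecord θ P (sitOfTerm θ P ((σT P).pinZpp (sT P) (N0OfRecord θ P (lam.kSel P + 1)) θ.τ9.Nmem (enl P)) (sT P) (N0OfRecord θ P (lam.kSel P + 1)) p₁) := rfl

/-- Its top new large-field region: `Z″_k = (Ω^{∼5}_{k₀+1})ᶜ ∩ Z` at `k = kSel P + 1`, `k₀ + 1 = kSel P + 2 − N₀(P)` (for `2 ≤ N₀(P) ≤ Nmem`).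
[cite: Balaban1989LargeFieldI, (1.10) p.179] -/
theorem pinD189Z_Zpp_top (P : B12.RunParams) (hN2 : 2 ≤ N0OfRecord θ P (lam.kSel P + 1)) (hNN : N0OfRecord θ P (lam.kSel P + 1) ≤ θ.τ9.Nmem) :
    ((lam.pinD189Z θ σT sT enl p₁).D189 P).Zpp (lam.kSel P + 1) =
      (enl P 5 (lam.kSel P + 1 + 1 - N0OfRecord θ P (lam.kSel P + 1))
        (B15Claim189PrintedConditions.omegaOfChain (sT P) (lam.kSel P + 1 + 1 - N0OfRecord θ P (lam.kSel P + 1))))ᶜ ∩ (σT P).Z :=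
  zppOfChain_top (sT P) _ _ _ _ _ hN2 hNN

/-- The pin keeps `kSel`, `LF`, `D1100` and commutes with module 2's (1.100) pin (`rfl`). [cite: Balaban1989LargeFieldI, (0.2) p.176, (1.100) p.201 (bookkeeping)] -/
theorem pinD189Z_kSel_LF_D1100_comm : (lam.pinD189Z θ σT sT enl p₁).kSel = lam.kSel ∧ (lam.pinD189Z θ σT sT enl p₁).LF = lam.LF ∧
    (lam.pinD189Z θ σT sT enl p₁).D1100 = lam.D1100 ∧ (lam.pinD189Z θ σT sT enl p₁).pinRPrime θ = (lam.pinRPrime θ).pinD189Z θ σT sT enl p₁ := ⟨rfl, rfl, rfl, rfl⟩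

variable {θ}

/-- **dag-n12-d's `h189` SLOT AT THE `Z″`-AND-`N₀`-PINNED LAYER FROM ITS `h180` SLOT** (window form): module 12's `h189_pinD189N_of_h180` with `hZk` DISCHARGED (`enl` inflationary).
For `D = (λ.pinD189Z θ σ s enl p₁).D189 P` (`hD`, instantiate `rfl`). [cite: Balaban1989LargeFieldI, (1.89) p.198, pp.199–200, (1.10)–(1.11) p.179; Balaban1988Convergent, (2.1) p.254, (2.5)–(2.8) pp.255–256] -/
theorem h189_pinD189Z_of_h180 (P : B12.RunParams) (henl : ∀ n j (S : Set (Site (F.P P.K) 0)), S ⊆ enl P n j S)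
    {D : Setting189 (F.P P.K) (SU N) (MSField (F.P P.K) (SU N) × ((j : ℕ) → VecField (F.P P.K) j (EuclideanSpace ℝ (Fin (N ^ 2 - 1))))) (Pt (F.P P.K).d)}
    (hD : D = (lam.pinD189Z θ σT sT enl p₁).D189 P) (hr : 1 ≤ θ.ν.r)
    (hNN : N0OfRecord θ P (lam.kSel P + 1) ≤ θ.τ9.Nmem) (hNk : N0OfRecord θ P (lam.kSel P + 1) ≤ lam.kSel P + 1)
    (hβ0 : 0 ≤ (σT P).β) (hβ : (σT P).β ≤ 1 / 4) (hL₀ : 2 ≤ (σT P).L₀) (hL₀L : (σT P).L₀ ^ 2 ≤ ((F.P P.K).L : ℝ))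
    (hB : 0 ≤ (σT P).O1 * (σT P).B₃ * (σT P).B₅) (hδ : 0 ≤ (σT P).δ) (hdist : ∀ p, 0 ≤ (σT P).dist p)
    (hwin : 4 * (2 + (121 / 120) ^ 2 * ((σT P).O1 * (σT P).B₃ * (σT P).B₅ * (θ.τ9.M : ℝ) ^ 5))
      ≤ ((Real.log (gOfRecord₁₀ F N θ P (lam.kSel P + 1) ^ 2)⁻¹) ^ θ.ν.r) ^ (Real.log ((σT P).L₀ ^ 2) / Real.log ((F.P P.K).L : ℝ)))
    (hβhist : ∀ j, j < lam.kSel P + 1 → 0 ≤ betaOfRecord₁₀ F N θ j (prefixOf (gOfRecord₁₀ F N θ P) j))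
    (hMl : (121 / 120) ^ 2 * ((σT P).O1 * (σT P).B₃ * (σT P).B₅ * (θ.τ9.M : ℝ) ^ 5) * Real.exp (-(4 * (σT P).δ * (θ.τ9.M : ℝ))) ≤ 1 / 12)
    (hA₀ : 0 ≤ θ.ν.A₀) {β' β₀ : ℝ} {L : ℕ} (S : SmallnessFor θ.γ β' β₀ L θ.ν.p₀) (hβ₀ : β₀ ≤ 1 / 2) (hε10 : θ.γ * p0Profile θ.ν.A₀ θ.ν.p₀ θ.γ ≤ 1 / 10)
    (hI : Step.InInterval θ.γ (lam.kSel P + 1) (gOfRecord₁₀ F N θ P)) (hup : BetaUpperH β' θ.γ (betaOfRecord₁₀ F N θ))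
    (hgeom : ∀ m, D.k₀ < m → m < D.k → ∀ p ∈ plaqsOf (D.Ω m \ D.Ω (m + 1)), 4 * ((m : ℝ) - D.k₀) * D.M ≤ D.dist p)
    (hbox : ∀ p ∈ plaqsOf (half D), D.boxOf p ∈ D.halfcubes ∧ p ∈ D.plaqT (D.boxOf p))
    (L91h : ∀ U, new189 D U → ∀ p ∈ plaqsOf (half D),
      Ineq191 (dist1 (plaqHol (D.Upp U) p)) (D.devV'' U p) D.α ((D.L ^ D.h)⁻¹) (D.ε D.h) (E124 D.ε D.L D.η D.k D.h))
    (L95 : ∀ U, new189 D U → ∀ p ∈ plaqsOf (half D),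
      Ineq195 (D.devV'' U p) (dist1 (plaqHol (D.Uhalf U (D.boxOf p)) p)) D.α ((D.L ^ D.h)⁻¹) (D.ε D.h) (E124 D.ε D.L D.η D.k D.h))
    (L91 : ∀ U, new189 D U → ∀ j, D.h ≤ j → j ≤ D.k → ∀ p ∈ plaqsOf (dom D j),
      Ineq191 (dist1 (plaqHol (D.Upp U) p)) (D.dev97 U p) D.α ((D.L ^ j)⁻¹) (D.ε j) (E124 D.ε D.L D.η D.k j))
    (L97 : ∀ U, new189 D U → ∀ j, D.h ≤ j → j ≤ D.k → ∀ p ∈ plaqsOf (dom D j),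
      Ineq191 (D.dev97 U p) (D.dev0 U p) D.α ((D.L ^ j)⁻¹) (D.ε j) (E124 D.ε D.L D.η D.k j))
    (h180 : ∀ U, new189 D U → ∀ i, D.h ≤ i → i ≤ D.k → ∀ q ∈ plaqsOf (dom D i), Ineq180 (D.dev0 U q) (D.ε D.k) D.η D.B₃ D.B₅ D.M D.δ (D.dist q) D.O1) :
    Claim189 (new189 D) (chiPP D) :=
  claim189_sitOfTerm_N0Z_of_inInterval P (σT P) (sT P) p₁ (enl P) henl hD hr hNN hNk hβ0 hβ hL₀ hL₀L hB hδ hdist hwin hβhist hMl hA₀ S hβ₀ hε10 hI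
    (B15Claim189FlowAtRecord.betaAlongHistory_le_of_betaUpperH hup hI) hgeom hbox L91h L95 L91 L97 h180

/-- **THE SAME, WINDOW-FREE FORM.** [cite: Balaban1989LargeFieldI, (1.89) p.198, pp.199–200, (1.10)–(1.11) p.179; Balaban1988Convergent, (2.5)–(2.8) pp.255–256] -/
theorem h189_pinD189Z_of_h180_of_flow (P : B12.RunParams) (henl : ∀ n j (S : Set (Site (F.P P.K) 0)), S ⊆ enl P n j S)
    {D : Setting189 (F.P P.K) (SU N) (MSField (F.P P.K) (SU N) × ((j : ℕ) → VecField (F.P P.K) j (EuclideanSpace ℝ (Fin (N ^ 2 - 1))))) (Pt (F.P P.K).d)}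
    (hD : D = (lam.pinD189Z θ σT sT enl p₁).D189 P)
    (hg1 : 1 < (Real.log (gOfRecord₁₀ F N θ P (lam.kSel P + 1) ^ 2)⁻¹) ^ θ.ν.r)
    (hNN : N0OfRecord θ P (lam.kSel P + 1) ≤ θ.τ9.Nmem) (hNk : N0OfRecord θ P (lam.kSel P + 1) ≤ lam.kSel P + 1)
    (hβ0 : 0 ≤ (σT P).β) (hβ : (σT P).β ≤ 1 / 4) (hL₀ : 2 ≤ (σT P).L₀) (hL₀L : (σT P).L₀ ^ 2 ≤ ((F.P P.K).L : ℝ))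
    (hB : 0 ≤ (σT P).O1 * (σT P).B₃ * (σT P).B₅) (hδ : 0 ≤ (σT P).δ) (hdist : ∀ p, 0 ≤ (σT P).dist p)
    (hwin : 4 * (2 + (121 / 120) ^ 2 * ((σT P).O1 * (σT P).B₃ * (σT P).B₅ * (θ.τ9.M : ℝ) ^ 5))
      ≤ ((Real.log (gOfRecord₁₀ F N θ P (lam.kSel P + 1) ^ 2)⁻¹) ^ θ.ν.r) ^ (Real.log ((σT P).L₀ ^ 2) / Real.log ((F.P P.K).L : ℝ)))
    {γ : ℝ} (hγ1 : γ ≤ 1) (hIγ : Step.InInterval γ (lam.kSel P + 1) (gOfRecord₁₀ F N θ P))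
    (hβhist : ∀ j, j < lam.kSel P + 1 → 0 ≤ betaOfRecord₁₀ F N θ j (prefixOf (gOfRecord₁₀ F N θ P) j))
    (hMl : (121 / 120) ^ 2 * ((σT P).O1 * (σT P).B₃ * (σT P).B₅ * (θ.τ9.M : ℝ) ^ 5) * Real.exp (-(4 * (σT P).δ * (θ.τ9.M : ℝ))) ≤ 1 / 12)
    (hε0 : ∀ i, lam.kSel P + 1 - θ.τ9.Nmem ≤ i → i ≤ lam.kSel P + 1 → 0 ≤ epsOfRecord θ.ν (gOfRecord₁₀ F N θ P) i)
    (hε1 : ∀ i, lam.kSel P + 1 - θ.τ9.Nmem ≤ i → i ≤ lam.kSel P + 1 → epsOfRecord θ.ν (gOfRecord₁₀ F N θ P) i ≤ 1 / 10)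
    {β₀ : ℝ} (hβ₀0 : 0 ≤ β₀) (hβ₀ : β₀ ≤ 1 / 2)
    (hflow : ∀ j, lam.kSel P + 1 - θ.τ9.Nmem ≤ j → j < lam.kSel P + 1 →
      epsOfRecord θ.ν (gOfRecord₁₀ F N θ P) (lam.kSel P + 1) ≤ (1 + β₀) * Real.sqrt ((lam.kSel P + 1 - j : ℕ) : ℝ) * epsOfRecord θ.ν (gOfRecord₁₀ F N θ P) j)
    (hgeom : ∀ m, D.k₀ < m → m < D.k → ∀ p ∈ plaqsOf (D.Ω m \ D.Ω (m + 1)), 4 * ((m : ℝ) - D.k₀) * D.M ≤ D.dist p)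
    (hbox : ∀ p ∈ plaqsOf (half D), D.boxOf p ∈ D.halfcubes ∧ p ∈ D.plaqT (D.boxOf p))
    (L91h : ∀ U, new189 D U → ∀ p ∈ plaqsOf (half D),
      Ineq191 (dist1 (plaqHol (D.Upp U) p)) (D.devV'' U p) D.α ((D.L ^ D.h)⁻¹) (D.ε D.h) (E124 D.ε D.L D.η D.k D.h))
    (L95 : ∀ U, new189 D U → ∀ p ∈ plaqsOf (half D),
      Ineq195 (D.devV'' U p) (dist1 (plaqHol (D.Uhalf U (D.boxOf p)) p)) D.α ((D.L ^ D.h)⁻¹) (D.ε D.h) (E124 D.ε D.L D.η D.k D.h))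
    (L91 : ∀ U, new189 D U → ∀ j, D.h ≤ j → j ≤ D.k → ∀ p ∈ plaqsOf (dom D j),
      Ineq191 (dist1 (plaqHol (D.Upp U) p)) (D.dev97 U p) D.α ((D.L ^ j)⁻¹) (D.ε j) (E124 D.ε D.L D.η D.k j))
    (L97 : ∀ U, new189 D U → ∀ j, D.h ≤ j → j ≤ D.k → ∀ p ∈ plaqsOf (dom D j),
      Ineq191 (D.dev97 U p) (D.dev0 U p) D.α ((D.L ^ j)⁻¹) (D.ε j) (E124 D.ε D.L D.η D.k j))
    (h180 : ∀ U, new189 D U → ∀ i, D.h ≤ i → i ≤ D.k → ∀ q ∈ plaqsOf (dom D i), Ineq180 (D.dev0 U q) (D.ε D.k) D.η D.B₃ D.B₅ D.M D.δ (D.dist q) D.O1) :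
    Claim189 (new189 D) (chiPP D) :=
  claim189_sitOfTerm_N0Z_of_flow P (σT P) (sT P) p₁ (enl P) henl hD hg1 hNN hNk hβ0 hβ hL₀ hL₀L hB hδ hdist hwin hγ1 hIγ hβhist hMl hε0 hε1 hβ₀0 hβ₀ hflow hgeom
    hbox L91h L95 L91 L97 h180

end Layer

end B15Claim189ZppPin

end Literature.MathematicalPhysics.QuantumFieldTheory.Balaban1983to89

end
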